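import Summits.CriticalPhenomena.PercolationContinuityZ3.Theorems.Transplant.FKDoubleFanSesquiConeCrossRays
import HarnessLib

/-!
# Double fans `K₂ ∨ P_{m+1}`: RAY-TANGENT ATOMS for the local criterion of the dressed cone — the spoke-weight-1 part of a single-fan image pairs
# non-negatively with every dual element that kills the corresponding fully dressed ray, and faces transfer along `g − λ·e ∈ cone15`

Helper file (`--supports stmt-CriticalPhenomena-4575`), FK sub-lane `prim-bschramm-fk-3` (gen 43); builds on p205010 (kernel theorem, internal
audit signed; external expert review pending).  No named facts, no sorries; standard axioms.  Memo `bschramm/prim-bschramm-fk-3/FAR-CROSS-XVIII.md` §3b.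

The certificates for `CrossPosD15` (`…SesquiConeCross`) on the rank-deficient strata of the dressed families (memo §3b: the dressed V-cells
`∧²AC_x·imgB(B_yE_ρ, BC_β)`, 100/100 tested cells) are of the form
`T_D g = C·g + (two-sided tangents of g's own family) + Σ c_i u_i`, `c_i ≥ 0`, where the `u_i` are either genuine members of `cone15 q`
(`a∧b`, `e_yv`, `e_zv`, `e_xv`, `ι(1̂)`) or LIMIT TANGENT DIRECTIONS at the fully dressed rays: the `T_b`-weight-1 part **`tanB1 a`**
`= ⟨0,0,a_uz,a_uv,0,a_xz,a_xv,a_yz,a_yv,0⟩` of an `a`-image `a` (the velocity of `δ ↦ ∧²BC_{1−δ}·a` at the ray `a_zv·e_zv`, **`opBC_explicit'`**) and the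
`T_a`-weight-1 part **`tanA1 b`** of a `b`-image.  These are NOT members of `cone15 q` in general (memo: `tanB1 ι(1̂)` is separated), but they pair
non-negatively with every `ρ ∈ DualS15 q` that KILLS THE RAY: **`pairH_tanB1_nonneg`** (`⟪e_zv, ρ⟫ = 0 ⟹ ⟪tanB1 (imgA q F w), ρ⟫ ≥ 0`, legs in `InS q`,
`0 < q ≤ 1`) and **`pairH_tanA1_nonneg`** — by the first-order lemma of `…CrossRays` applied to `⟪∧²BC_{1−δ}·imgA, ρ⟫ ≥ 0`.  The ray is killed by every
`ρ` in the face of `g` as soon as `g − λ·e_zv ∈ cone15 q` for some `λ > 0` (**`pairH_eq_zero_of_face`**, the face-transfer lemma).  So a V-cell certificate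
needs, besides the identity and the signs, only the two face memberships `g − λ_z e_zv, g − λ_y e_yv ∈ cone15 q`. [folklore]
-/

noncomputable section

namespace Summit.CriticalPhenomena.PercolationContinuityZ3.Theorems

namespace FK

namespace ThreeApex

/-- The `T_b`-weight-1 part of a bivector (coordinates with exactly one index in `{z,v}`): the tangent direction of `δ ↦ ∧²BC_{1−δ}β` at the
ray `β_zv·e_zv`. [folklore] -/
def tanB1 (β : Biv) : Biv := ⟨0, 0, β.uz, β.uv, 0, β.xz, β.xv, β.yz, β.yv, 0⟩

/-- The `T_a`-weight-1 part of a bivector (exactly one index in `{y,v}`): the tangent direction of `δ ↦ ∧²AC_{1−δ}β` at the ray `β_yv·e_yv`. [folklore] -/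
def tanA1 (β : Biv) : Biv := ⟨0, β.uy, 0, β.uv, β.xy, 0, β.xv, β.yz, 0, β.zv⟩

/-- `⟪∧²BC_{1−δ} β, ρ⟫ = δ²·⟪weight-0 part, ρ⟫ + δ·⟪tanB1 β, ρ⟫ + ⟪β_zv e_zv, ρ⟫`. [folklore] -/
theorem pairH_opBC_one_sub (q δ : ℝ) (β ρ : Biv) :
    pairH q (opBC (1 - δ) β) ρ = δ ^ 2 * pairH q (⟨β.ux, β.uy, 0, 0, β.xy, 0, 0, 0, 0, 0⟩ : Biv) ρ + δ * pairH q (tanB1 β) ρ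
      + pairH q (⟨0, 0, 0, 0, 0, 0, 0, 0, 0, β.zv⟩ : Biv) ρ := by
  simp only [pairH, opBC, opTb, opWb, tanB1, Biv.lin3, Biv.add, Biv.smul]; ring

/-- `⟪∧²AC_{1−δ} β, ρ⟫ = δ²·⟪weight-0 part, ρ⟫ + δ·⟪tanA1 β, ρ⟫ + ⟪β_yv e_yv, ρ⟫`. [folklore] -/
theorem pairH_opAC_one_sub (q δ : ℝ) (β ρ : Biv) :
    pairH q (opAC (1 - δ) β) ρ = δ ^ 2 * pairH q (⟨β.ux, 0, β.uz, 0, 0, β.xz, 0, 0, 0, 0⟩ : Biv) ρ + δ * pairH q (tanA1 β) ρ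
      + pairH q (⟨0, 0, 0, 0, 0, 0, 0, 0, β.yv, 0⟩ : Biv) ρ := by
  simp only [pairH, opAC, opTa, opWa, tanA1, Biv.lin3, Biv.add, Biv.smul]; ring

/-- The ray component pairs through `e_zv`: `⟪β_zv·e_zv, ρ⟫ = β_zv·⟪e_zv, ρ⟫`. [folklore] -/
theorem pairH_zvRay (q : ℝ) (β ρ : Biv) :
    pairH q (⟨0, 0, 0, 0, 0, 0, 0, 0, 0, β.zv⟩ : Biv) ρ = β.zv * pairH q (⟨0, 0, 0, 0, 0, 0, 0, 0, 0, 1⟩ : Biv) ρ := by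
  simp only [pairH]; ring

/-- The ray component pairs through `e_yv`. [folklore] -/
theorem pairH_yvRay (q : ℝ) (β ρ : Biv) :
    pairH q (⟨0, 0, 0, 0, 0, 0, 0, 0, β.yv, 0⟩ : Biv) ρ = β.yv * pairH q (⟨0, 0, 0, 0, 0, 0, 0, 0, 1, 0⟩ : Biv) ρ := by
  simp only [pairH]; ring

/-- **Ray-tangent atoms at `e_zv`**: if `ρ ∈ DualS15 q` kills the ray `e_zv`, then `⟪tanB1 (imgA q F w), ρ⟫ ≥ 0` for all `F, w ∈ InS q`. [folklore] -/
theorem pairH_tanB1_nonneg {q : ℝ} {ρ : Biv} (hρ : DualS15 q ρ) (h0 : pairH q (⟨0, 0, 0, 0, 0, 0, 0, 0, 0, 1⟩ : Biv) ρ = 0)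
    {F w : V5} (hF : InS q F) (hw : InS q w) : 0 ≤ pairH q (tanB1 (imgA q F w)) ρ := by
  refine nonneg_of_quadratic_curve (B := pairH q (⟨(imgA q F w).ux, (imgA q F w).uy, 0, 0, (imgA q F w).xy, 0, 0, 0, 0, 0⟩ : Biv) ρ) ?_
  intro δ hδ0 hδ1
  have hmem := hρ.2.2 F w (1 - δ) hF hw (by linarith) (by linarith)
  rw [pairH_opBC_one_sub, pairH_zvRay, h0, mul_zero, add_zero] at hmem
  linarith

/-- **Ray-tangent atoms at `e_yv`**: if `ρ ∈ DualS15 q` kills the ray `e_yv`, then `⟪tanA1 (imgB q G w), ρ⟫ ≥ 0` for all `G, w ∈ InS q`. [folklore] -/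
theorem pairH_tanA1_nonneg {q : ℝ} {ρ : Biv} (hρ : DualS15 q ρ) (h0 : pairH q (⟨0, 0, 0, 0, 0, 0, 0, 0, 1, 0⟩ : Biv) ρ = 0)
    {G w : V5} (hG : InS q G) (hw : InS q w) : 0 ≤ pairH q (tanA1 (imgB q G w)) ρ := by
  refine nonneg_of_quadratic_curve (B := pairH q (⟨(imgB q G w).ux, 0, (imgB q G w).uz, 0, 0, (imgB q G w).xz, 0, 0, 0, 0⟩ : Biv) ρ) ?_
  intro δ hδ0 hδ1
  have hmem := hρ.2.1 G w (1 - δ) hG hw (by linarith) (by linarith)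
  rw [pairH_opAC_one_sub, pairH_yvRay, h0, mul_zero, add_zero] at hmem
  linarith

/-- **Face transfer**: if `g − λ·e ∈ cone15 q` with `λ > 0`, `e ∈ cone15 q`, and `ρ ∈ DualS15 q` kills `g`, then `ρ` kills `e`. [folklore] -/
theorem pairH_eq_zero_of_face {q : ℝ} {g e ρ : Biv} {lam : ℝ} (hlam : 0 < lam) (hface : Biv.add g (Biv.smul (-lam) e) ∈ cone15 q)
    (he : e ∈ cone15 q) (hρ : DualS15 q ρ) (h0 : pairH q g ρ = 0) : pairH q e ρ = 0 := by
  have h1 := hface ρ hρ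
  rw [pairH_add_left, pairH_smul_left, h0, zero_add] at h1
  have h2 := he ρ hρ
  nlinarith

/-- The ray `e_zv` lies in `cone15 q` (it is the fully dressed `a`-image `∧²BC_1·(a∧b)`; `0 < q ≤ 1`). [folklore] -/
theorem ezv_mem_cone15 {q : ℝ} (hq0 : 0 < q) (hq1 : q ≤ 1) : (⟨0, 0, 0, 0, 0, 0, 0, 0, 0, 1⟩ : Biv) ∈ cone15 q := by
  have hab : InS q (rimStep q 0 fanInit) := ((fanInit_inKE q).inS hq0 hq1).rimStep hq0 hq1 le_rfl zero_le_one
  have hw : InS q (edgeBC 1) := (IsLetter.bc zero_le_one le_rfl).inS hq0 hq1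
  have e : (⟨0, 0, 0, 0, 0, 0, 0, 0, 0, 1⟩ : Biv) = opBC 1 (imgA q (rimStep q 0 fanInit) (edgeBC 1)) := by
    rw [← abBiv_eq_imgA, opBC_abBiv]; norm_num
  rw [e]; exact opBC_imgA_mem_cone15 hab hw zero_le_one le_rfl

/-- The ray `e_yv` lies in `cone15 q` (`∧²AC_1·(a∧b)`; `0 < q ≤ 1`). [folklore] -/
theorem eyv_mem_cone15 {q : ℝ} (hq0 : 0 < q) (hq1 : q ≤ 1) : (⟨0, 0, 0, 0, 0, 0, 0, 0, 1, 0⟩ : Biv) ∈ cone15 q := by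
  have hab : InS q (rimStep q 0 fanInit) := ((fanInit_inKE q).inS hq0 hq1).rimStep hq0 hq1 le_rfl zero_le_one
  have hw : InS q (edgeBC 1) := (IsLetter.bc zero_le_one le_rfl).inS hq0 hq1
  have e : (⟨0, 0, 0, 0, 0, 0, 0, 0, 1, 0⟩ : Biv) = opAC 1 (imgB q (rimStep q 0 fanInit) (edgeBC 1)) := by
    rw [← abBiv_eq_imgB, opAC_abBiv]; norm_num
  rw [e]; exact opAC_imgB_mem_cone15 hab hw zero_le_one le_rfl

end ThreeApex

end FK

end Summit.CriticalPhenomena.PercolationContinuityZ3.Theorems
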